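import Mathlib.RingTheory.Valuation.ValuationSubring
import Mathlib.RingTheory.LocalRing.ResidueField.Basic
import Mathlib.RingTheory.Algebraic.Integral
import Mathlib.RingTheory.Ideal.GoingUp
import Mathlib.Algebra.Polynomial.Lifts
import HarnessLib

/-!
# Residually algebraic valuations: passing to an integral subring and to an algebraic extension

Topic: `Literature/AlgebraicGeometry/Resolution`. Cossart–Piltant's local uniformization
property (LU) of a local domain `(A, 𝔪, k)` (`CPLocalUniformization`, `ArithmeticalThreefolds.lean`)
quantifies over valuation rings `O ⊇ A` of `K = Frac A` dominating `A` "with residue field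
algebraic over `k`", rendered elementarily: every `x ∈ O` is a root modulo `𝔪_O` of a
polynomial over `A` not all of whose coefficients lie in `𝔪`. In the reduction of (LU) for a
complete local domain `A` to the local theorem (`CossartPiltant2019ReductionP`,
`ArithmeticalThreefoldsLocal.lean`; Cossart–Piltant 2019, proof of Prop. 4.10 = arXiv v1
Prop. 4.8) this hypothesis has to be moved twice: DOWN to the complete regular local subring
`S ⊆ A` of Cohen's structure theorem (`A` finite over `S`), over which the models are built, and
UP to an extension `v̄` of `v` to a finite (Galois) extension `E ⊇ K`, along which the
ramification-theoretic tower is climbed; it is what keeps the local rings of the models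
three-dimensional (`LocalModels.lean`, `DimensionFormula.lean`). This file PROVES the transfer:

* `isLocalHom_algebraMap_of_isIntegral` — an integral homomorphism of local rings is local;
* `valuation_algebraMap_lt_one_of_isLocalHom`, `valuation_algebraMap_lt_one_iff_of_comap_eq'` —
  domination passes down to `S` and up to `O_E` (`O_E ∩ K = O`);
* `forall_exists_valuation_eval₂_lt_one_of_tower` — **residue algebraicity passes from
  `(A, K, O)` to `(S, E, O_E)`** for `S → A` integral local, `E ⊇ K` algebraic, `O_E ∩ K = O`:
  the tower of residue fields `S/𝔪_S → A/𝔪_A → κ(O) → κ(O_E)` is algebraic (integral;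
  hypothesis; divide an annihilating polynomial over `K` by a coefficient of maximal value), and
  Mathlib's transitivity of algebraicity over fields.

Everything is PROVED; no named facts are introduced.

## Sources

* V. Cossart, O. Piltant, J. Algebra 529 (2019) 268–535 = arXiv:1412.0868, §4.1 (LU) and the
  proof of Prop. 4.10 (arXiv v1: Prop. 4.8, pp. 53–54). [CossartPiltant2019]
* N. Bourbaki, *Algèbre commutative*, Ch. VI §8 no. 1 (residue extension of an algebraic
  extension is algebraic). [BourbakiAC5to7]
-/

noncomputable section

open IsLocalRing Polynomial

namespace Literature.AlgebraicGeometry.Resolution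

universe u

section Tower

variable {S A K E : Type u} [CommRing S] [CommRing A] [Field K] [Field E]

/-- An integral homomorphism of local rings is local. [folklore] -/
theorem isLocalHom_algebraMap_of_isIntegral [IsLocalRing S] [IsLocalRing A] [Algebra S A]
    [Algebra.IsIntegral S A] : IsLocalHom (algebraMap S A) := by
  refine ⟨fun a ha => ?_⟩
  by_contra hna
  have hmem : a ∈ maximalIdeal S := (IsLocalRing.mem_maximalIdeal a).mpr hna
  have hunder : (maximalIdeal A).under S = maximalIdeal S :=
    IsLocalRing.eq_maximalIdeal (Ideal.IsMaximal.under S (maximalIdeal A))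
  have : algebraMap S A a ∈ maximalIdeal A := by
    rw [← hunder, Ideal.under_def, Ideal.mem_comap] at hmem
    exact hmem
  exact (IsLocalRing.mem_maximalIdeal _).mp this ha

/-- Domination passes to a subring along a local homomorphism `S → A`. [folklore] -/
theorem valuation_algebraMap_lt_one_of_isLocalHom [IsLocalRing S] [IsLocalRing A] [Algebra S A]
    [IsLocalHom (algebraMap S A)] [Algebra A K] [Algebra S K] [IsScalarTower S A K]
    (O : ValuationSubring K) (hdom : ∀ a ∈ maximalIdeal A, O.valuation (algebraMap A K a) < 1)
    (s : S) (hs : s ∈ maximalIdeal S) : O.valuation (algebraMap S K s) < 1 := by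
  rw [IsScalarTower.algebraMap_apply S A K]
  refine hdom _ ((IsLocalRing.mem_maximalIdeal _).mpr fun hu => ?_)
  exact ((IsLocalRing.mem_maximalIdeal s).mp hs) (IsLocalHom.map_nonunit s hu)

/-- `v_E(x) < 1 ↔ v(x) < 1` on `K` when `O_E ∩ K = O`. [folklore] -/
theorem valuation_algebraMap_lt_one_iff_of_comap_eq' [Algebra K E] (O : ValuationSubring K)
    (OE : ValuationSubring E) (hOE : OE.comap (algebraMap K E) = O) (x : K) :
    OE.valuation (algebraMap K E x) < 1 ↔ O.valuation x < 1 := by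
  rw [← ValuationSubring.mem_nonunits_iff, ← ValuationSubring.mem_nonunits_iff,
    ValuationSubring.mem_nonunits_iff_or, ValuationSubring.mem_nonunits_iff_or, map_eq_zero,
    ← map_inv₀, ← ValuationSubring.mem_comap, hOE]

variable [IsLocalRing S] [IsLocalRing A] [Algebra S A] [Algebra.IsIntegral S A] [Algebra A K]
  [Algebra S K] [IsScalarTower S A K] [Algebra K E] [Algebra S E] [IsScalarTower S K E]
  (O : ValuationSubring K) (OE : ValuationSubring E)

/-- **Residue algebraicity along a tower** (elementary rendering, as in Cossart–Piltant's (LU),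
`CPLocalUniformization`: "every element of `O` is a root modulo `𝔪_O` of a polynomial over `A`
not all of whose coefficients lie in `𝔪_A`", i.e. the residue field of `O` is algebraic over that
of `A`). Let `S → A` be an integral homomorphism of local rings, `A → K` with `A ⊆ O` dominated by
the valuation ring `O` of `K`, `E ⊇ K` an algebraic extension and `O_E` a valuation ring of `E`
with `O_E ∩ K = O`. If the residue field of `O` is algebraic over `A/𝔪_A`, then the residue
field of `O_E` is algebraic over `S/𝔪_S` (tower of residue fields: `S/𝔪_S ⊆ A/𝔪_A` is integral,
`κ(O) ⊇ A/𝔪_A` is algebraic by hypothesis, and `κ(O_E) ⊇ κ(O)` is algebraic because `E ⊇ K` is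
— divide an annihilating polynomial by a coefficient of maximal value). [folklore] -/
theorem forall_exists_valuation_eval₂_lt_one_of_tower (hOE : OE.comap (algebraMap K E) = O)
    [Algebra.IsAlgebraic K E] (hAO : ∀ a : A, algebraMap A K a ∈ O)
    (hdom : ∀ a ∈ maximalIdeal A, O.valuation (algebraMap A K a) < 1)
    (halg : ∀ x : O, ∃ p : A[X], (∃ i, p.coeff i ∉ maximalIdeal A) ∧
      O.valuation (p.eval₂ (algebraMap A K) x) < 1)
    (y : OE) : ∃ p : S[X], (∃ i, p.coeff i ∉ maximalIdeal S) ∧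
      OE.valuation (p.eval₂ (algebraMap S E) y) < 1 := by
  classical
  haveI : IsLocalHom (algebraMap S A) := isLocalHom_algebraMap_of_isIntegral
  -- the maps `A → O → O_E → κ(O_E)`
  have hOOE : ∀ x : O, algebraMap K E x ∈ OE := fun x => by
    rw [← ValuationSubring.mem_comap, hOE]; exact x.2
  let gA : A →+* O := (algebraMap A K).codRestrict O hAO
  let ι : O →+* OE := ((algebraMap K E).comp O.subtype).codRestrict OE hOOE
  let π : OE →+* ResidueField OE := residue OE
  have hvKE : ∀ x : O, OE.valuation (algebraMap K E x) < 1 ↔ O.valuation (x : K) < 1 := fun x =>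
    valuation_algebraMap_lt_one_iff_of_comap_eq' O OE hOE x
  -- the three local homomorphisms
  haveI hgAloc : IsLocalHom gA := by
    refine ⟨fun a ha => ?_⟩
    by_contra hna
    have hmem : a ∈ maximalIdeal A := (IsLocalRing.mem_maximalIdeal a).mpr hna
    have h1 : O.valuation (algebraMap A K a) = 1 := (O.valuation_eq_one_iff _).mp ha
    have h2 := hdom a hmem
    rw [h1] at h2
    exact lt_irrefl _ h2
  haveI hιloc : IsLocalHom ι := by
    refine ⟨fun x hx => ?_⟩
    have h1 : OE.valuation (algebraMap K E x) = 1 := (OE.valuation_eq_one_iff _).mp hx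
    rw [O.valuation_eq_one_iff]
    have hle : O.valuation (x : K) ≤ 1 := (O.valuation_le_one_iff _).mpr x.2
    rcases hle.lt_or_eq with hlt | heq
    · have h2 := (hvKE x).mpr hlt
      rw [h1] at h2
      exact absurd h2 (lt_irrefl _)
    · exact heq
  haveI hπιloc : IsLocalHom (π.comp ι) := by
    refine ⟨fun x hx => ?_⟩
    have hne : π (ι x) ≠ 0 := hx.ne_zero
    rw [Ne, IsLocalRing.residue_eq_zero_iff] at hne
    have hu : IsUnit (ι x) := by
      by_contra h
      exact hne ((IsLocalRing.mem_maximalIdeal _).mpr h)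
    exact IsLocalHom.map_nonunit x hu
  -- residue fields `k_S → k_A → k_O → κ(O_E)` as a tower of algebras
  let φO : ResidueField O →+* ResidueField OE := ResidueField.lift (π.comp ι)
  let mAO : ResidueField A →+* ResidueField O := ResidueField.map gA
  let mSA : ResidueField S →+* ResidueField A := ResidueField.map (algebraMap S A)
  letI : Algebra (ResidueField O) (ResidueField OE) := φO.toAlgebra
  letI : Algebra (ResidueField A) (ResidueField O) := mAO.toAlgebra
  letI : Algebra (ResidueField S) (ResidueField A) := mSA.toAlgebra
  letI : Algebra (ResidueField A) (ResidueField OE) := (φO.comp mAO).toAlgebra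
  letI : Algebra (ResidueField S) (ResidueField OE) := ((φO.comp mAO).comp mSA).toAlgebra
  haveI : IsScalarTower (ResidueField A) (ResidueField O) (ResidueField OE) :=
    IsScalarTower.of_algebraMap_eq fun _ => rfl
  haveI : IsScalarTower (ResidueField S) (ResidueField A) (ResidueField OE) :=
    IsScalarTower.of_algebraMap_eq fun _ => rfl
  -- (1) `k_A` is algebraic (integral) over `k_S`
  haveI : Algebra.IsAlgebraic (ResidueField S) (ResidueField A) := by
    refine ⟨fun z => ?_⟩
    obtain ⟨a, rfl⟩ := IsLocalRing.residue_surjective z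
    obtain ⟨f, hfm, hfa⟩ := Algebra.IsIntegral.isIntegral (R := S) a
    have hint : IsIntegral (ResidueField S) (residue A a) := by
      refine ⟨f.map (residue S), hfm.map _, ?_⟩
      rw [eval₂_map]
      change eval₂ ((ResidueField.map (algebraMap S A)).comp (residue S)) (residue A a) f = 0
      rw [ResidueField.map_comp_residue, ← hom_eval₂, hfa, map_zero]
    exact hint.isAlgebraic
  -- (2) `k_O` is algebraic over `k_A` (the hypothesis)
  haveI : Algebra.IsAlgebraic (ResidueField A) (ResidueField O) := by
    refine ⟨fun z => ?_⟩
    obtain ⟨x, rfl⟩ := IsLocalRing.residue_surjective z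
    obtain ⟨q, ⟨i, hi⟩, hv⟩ := halg x
    refine ⟨q.map (residue A), ?_, ?_⟩
    · intro h0
      apply hi
      have := congrArg (fun r => r.coeff i) h0
      simp only [coeff_map, coeff_zero] at this
      exact (IsLocalRing.residue_eq_zero_iff _).mp this
    · rw [aeval_def, eval₂_map]
      change eval₂ ((ResidueField.map gA).comp (residue A)) (residue O x) q = 0
      rw [ResidueField.map_comp_residue, ← hom_eval₂, IsLocalRing.residue_eq_zero_iff,
        ValuationSubring.valuation_lt_one_iff]
      have : ((eval₂ gA x q : O) : K) = q.eval₂ (algebraMap A K) (x : K) := by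
        change O.subtype (eval₂ gA x q) = _
        rw [hom_eval₂]
        rfl
      rw [this]
      exact hv
  -- (3) the residue of `y` is algebraic over `k_O`: scale an annihilating polynomial over `K`
  have h3 : IsAlgebraic (ResidueField O) (π y) := by
    obtain ⟨p, hp0, hpy⟩ := Algebra.IsAlgebraic.isAlgebraic (R := K) (y : E)
    obtain ⟨j, hj, hmax⟩ := Finset.exists_max_image p.support (fun i => O.valuation (p.coeff i))
      (Polynomial.support_nonempty.mpr hp0)
    set c := p.coeff j with hc
    have hc0 : c ≠ 0 := mem_support_iff.mp hj
    set q : K[X] := C c⁻¹ * p with hq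
    have hq_coeff : ∀ i, q.coeff i = c⁻¹ * p.coeff i := fun i => by rw [hq, coeff_C_mul]
    have hqO : ∀ i, q.coeff i ∈ O := by
      intro i
      rw [hq_coeff, ← O.valuation_le_one_iff, map_mul, map_inv₀]
      by_cases hi : i ∈ p.support
      · have hvc : O.valuation c ≠ 0 := by rwa [Ne, map_eq_zero]
        calc (O.valuation c)⁻¹ * O.valuation (p.coeff i)
            ≤ (O.valuation c)⁻¹ * O.valuation c := by gcongr; exact hmax i hi
          _ = 1 := inv_mul_cancel₀ hvc
      · rw [Polynomial.notMem_support_iff.mp hi, map_zero, mul_zero]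
        exact zero_le
    have hqj : q.coeff j = 1 := by rw [hq_coeff, ← hc, inv_mul_cancel₀ hc0]
    have hqy : aeval (y : E) q = 0 := by rw [hq, map_mul, hpy, mul_zero]
    have hlift : q ∈ Polynomial.lifts O.subtype := by
      rw [lifts_iff_coeff_lifts]
      exact fun i => ⟨⟨q.coeff i, hqO i⟩, rfl⟩
    obtain ⟨qO, hqOq⟩ := (mem_lifts _).mp hlift
    refine ⟨qO.map (residue O), ?_, ?_⟩
    · intro h0
      have h1 := congrArg (fun r => r.coeff j) h0
      simp only [coeff_map, coeff_zero, IsLocalRing.residue_eq_zero_iff] at h1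
      have h2 : ((qO.coeff j : O) : K) = 1 := by
        have := congrArg (fun r => r.coeff j) hqOq
        simp only [coeff_map] at this
        rw [hqj] at this
        exact this
      have h3 : qO.coeff j = 1 := Subtype.ext h2
      rw [h3] at h1
      exact (Ideal.ne_top_iff_one _).mp (Ideal.IsPrime.ne_top inferInstance) h1
    · rw [aeval_def, eval₂_map]
      change eval₂ ((ResidueField.lift (π.comp ι)).comp (residue O)) (π y) qO = 0
      rw [ResidueField.lift_comp_residue, ← hom_eval₂]
      have hz : eval₂ ι y qO = 0 := by
        apply Subtype.ext
        change OE.subtype (eval₂ ι y qO) = 0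
        rw [hom_eval₂, show OE.subtype.comp ι = (algebraMap K E).comp O.subtype from
          RingHom.ext fun _ => rfl, ← eval₂_map, hqOq]
        exact hqy
      rw [hz, map_zero]
  -- (4) hence algebraic over `k_S`
  have h4 : IsAlgebraic (ResidueField S) (π y) :=
    IsAlgebraic.restrictScalars (ResidueField S)
      (IsAlgebraic.restrictScalars (ResidueField A) h3)
  -- (5) unfold: lift an annihilating polynomial over `k_S` to `S`
  obtain ⟨r, hr0, hr⟩ := h4
  obtain ⟨p, rfl⟩ := Polynomial.map_surjective (residue S) IsLocalRing.residue_surjective r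
  refine ⟨p, ?_, ?_⟩
  · by_contra hall
    push Not at hall
    apply hr0
    ext i
    rw [coeff_map, coeff_zero, IsLocalRing.residue_eq_zero_iff]
    exact hall i
  · rw [aeval_def, eval₂_map] at hr
    have hcomp : (algebraMap (ResidueField S) (ResidueField OE)).comp (residue S) =
        π.comp (ι.comp (gA.comp (algebraMap S A))) := by
      change ((φO.comp mAO).comp mSA).comp (residue S) = _
      ext s
      simp only [RingHom.comp_apply, φO, mAO, mSA, ResidueField.map_residue,
        ResidueField.lift_residue_apply]
    rw [hcomp, ← hom_eval₂, IsLocalRing.residue_eq_zero_iff,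
      ValuationSubring.valuation_lt_one_iff] at hr
    have heq : ((eval₂ (ι.comp (gA.comp (algebraMap S A))) y p : OE) : E) =
        p.eval₂ (algebraMap S E) (y : E) := by
      change OE.subtype _ = _
      rw [hom_eval₂]
      congr 1
      ext s
      change algebraMap K E (algebraMap A K (algebraMap S A s)) = algebraMap S E s
      rw [← IsScalarTower.algebraMap_apply S A K, ← IsScalarTower.algebraMap_apply S K E]
    rw [heq] at hr
    exact hr

end Tower

end Literature.AlgebraicGeometry.Resolution
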